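import Summits.BirchSwinnertonDyer.BirchSwinnertonDyer.Theorems.GenusKolyvaginAtTwoPowDvdShaCardAtTwoRTEigenNorms
import HarnessLib

/-!
# Route `GenusKolyvaginAtTwo`, crux L_T `PowDvdShaCardAtTwoRT` (stmt-BirchSwinnertonDyer-23242), LINE 18 stub 3a⁗ —
# THE LOST-BIT LAW at a Kolyvagin prime over `K` at `p = 2`: a `τ`-fixed class of order `2^{N_x}` and a `τ`-anti-fixed class of
# order `2^{N_y}` pair with EXACT order `2^(N_x + N_y − (M+1))`; same-sign classes are orthogonal (part 2 of 2)

LEAD seat `bsd-line-gk2-p1` g15 (cell `bsd-f1-sign2`), `--supports stmt-BirchSwinnertonDyer-23242` (helper). Mathlib-only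
algebra over part 1 (`…RTEigenNorms.lean`); THEOREMS ONLY. BSD is not proved by this file; neither is the crux.

WHY (memo `Cruxes/PowDvdShaCardAtTwoRT/Lines/plus-descent-lead-g15.md`): Kolyvagin's prime-swapping step (McCallum 1991, proof of
Prop. 5.2; Kolyvagin, Math. Ann. 291 (1991) Thm. 2.1 via [LNM 1479, Prop. 8]) compares the ORDERS of the two surviving terms of a
two-term reciprocity law between the classes `c_M(n₀ℓ′)` and `c_M(n₀ℓ₀)` at the Kolyvagin primes `λ′`, `λ₀`. In Frobenius
coordinates both local terms are a `τ`-anti-invariant perfect alternating pairing (the Weil pairing `e_{2^M}`; McCallum §2,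
Lemma 5.3, Prop. 4.4) evaluated on a `τ`-FIXED class (even depth) against a `τ`-ANTI-FIXED class (odd depth) — Kolyvagin's
classes are `τ`-eigen with sign alternating in the depth. For odd `p` the `±`-eigenlines are in perfect duality (Lemma 5.3);
at `p = 2` over `K` on `Δ < 0` (`E[2^M]` free of rank one over `ℤ/2^M[C₂]`, route item Q1) THIS FILE shows the replacement:
**`addOrderOf (B x y) = 2^(N_x + N_y − (M + 1))`** for `τx = x` of order `2^{N_x}`, `τy = −y` of order `2^{N_y}` — exactly ONE bit
is lost, in either order of the arguments (`lostBit_addOrderOf_pairing_fixed_antifixed`), with the vanishing threshold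
`2^j • B x y = 0 ⟺ N_x + N_y ≤ M + 1 + j` (`pow_smul_pairing_eq_zero_iff`) and a multiplicative form for pairings valued in a
commutative group (`lostBit_orderOf_pairing_fixed_antifixed`, the shape of the tree's Weil-pairing hypotheses `hadd₁/hadd₂/halt`
+ `hgal` at `τ`). Since the lost bit occurs at BOTH places of the reciprocity law, it cancels in the order comparison
`a′ + b′ = a₀ + b₀`: Kolyvagin's engine survives at `2` over `K` (the cell's «lost bit», 23239 why-might-fail, made exact).

References: [McCallumLMS1991] §2, Prop. 4.4, §5 Lemma 5.3 and proof of Prop. 5.2; [Kolyvagin1991MathAnn] Thm. 2.1, 2.2;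
[GrossLMS1991] Prop. 6.2, §8; [MilneADT2006] I §2, Cor. 3.4; [SilvermanAEC2009] III.8.1.
-/

set_option autoImplicit false
-- `Summit.<P>.<Sub>` repeats `BirchSwinnertonDyer` by the tree's layout convention (D-0017)
set_option linter.dupNamespace false

namespace Summit.BirchSwinnertonDyer.BirchSwinnertonDyer.Theorems.GenusExact.PlusDescent

/-! ## §3 The lost-bit law (additive form) -/

section Law

variable {A R : Type*} [AddCommGroup A] [AddCommGroup R]
  (τ : A →+ A) (hτ : ∀ x, τ (τ x) = x) (B : A →+ A →+ R) (hanti : ∀ x y, B (τ x) (τ y) = -B x y)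
  {M : ℕ} (P₀ : A)
  (hspan : ∀ Q : A, ∃ a b : ℤ, Q = a • P₀ + b • τ P₀)
  (hfree : ∀ a b : ℤ, a • P₀ + b • τ P₀ = 0 → (2 ^ M : ℤ) ∣ a ∧ (2 ^ M : ℤ) ∣ b)
  (htor : (2 ^ M : ℤ) • P₀ = 0)

include hτ hanti hspan hfree htor in
/-- **Same-sign classes are orthogonal (free module).** `τx = x`, `τx′ = x′ ⟹ B(x, x′) = 0`, and `τy = −y`, `τy′ = −y′ ⟹
B(y, y′) = 0`. [cite: McCallumLMS1991, §5 Lemma 5.3] -/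
theorem pairing_eq_zero_of_same_sign :
    (∀ x x' : A, τ x = x → τ x' = x' → B x x' = 0) ∧ (∀ y y' : A, τ y = -y → τ y' = -y' → B y y' = 0) := by
  constructor
  · intro x x' hx hx'
    obtain ⟨a, rfl⟩ := exists_eq_zsmul_norm_of_tau_eq τ hτ P₀ hspan hfree htor hx
    obtain ⟨a', rfl⟩ := exists_eq_zsmul_norm_of_tau_eq τ hτ P₀ hspan hfree htor hx'
    simp only [map_zsmul, AddMonoidHom.zsmul_apply]
    rw [pairing_norm_norm_eq_zero τ hτ B hanti, zsmul_zero, zsmul_zero]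
  · intro y y' hy hy'
    obtain ⟨a, rfl⟩ := exists_eq_zsmul_conorm_of_tau_eq_neg τ hτ P₀ hspan hfree htor hy
    obtain ⟨a', rfl⟩ := exists_eq_zsmul_conorm_of_tau_eq_neg τ hτ P₀ hspan hfree htor hy'
    simp only [map_zsmul, AddMonoidHom.zsmul_apply]
    rw [pairing_conorm_conorm_eq_zero τ hτ B hanti, zsmul_zero, zsmul_zero]

/-- The order bookkeeping behind the law: for `δ` of order `2^M` and multipliers `2^v s`, `2^w t` (`s`, `t` odd, `v, w < M`),
`(2^v s · 2^w t · 2) • δ` has order `2^((M − v) + (M − w) − (M + 1))`. [folklore] -/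
theorem addOrderOf_prod_two_smul_eq {δ : R} (hδ : addOrderOf δ = 2 ^ M) {v w s t : ℕ} (hv : v < M) (hw : w < M)
    (hs : Odd s) (ht : Odd t) :
    addOrderOf ((2 ^ v * s * (2 ^ w * t) * 2) • δ) = 2 ^ ((M - v) + (M - w) - (M + 1)) := by
  have hst : Odd (s * t) := hs.mul ht
  have hrw : 2 ^ v * s * (2 ^ w * t) * 2 = 2 ^ (v + w + 1) * (s * t) := by ring
  rw [hrw]
  by_cases hle : v + w + 1 ≤ M
  · rw [addOrderOf_two_pow_mul_odd_nsmul hδ hle hst]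
    congr 1
    omega
  · push Not at hle
    have h0 : (2 ^ (v + w + 1) * (s * t)) • δ = 0 :=
      (two_pow_mul_odd_nsmul_eq_zero_iff hδ _ _ hst).mpr hle.le
    rw [h0, addOrderOf_zero]
    have : (M - v) + (M - w) - (M + 1) = 0 := by omega
    rw [this, pow_zero]

include hτ hanti hspan hfree htor in
/-- **THE LOST-BIT LAW (fixed × anti-fixed).** In a free rank-one `ℤ/2^M[C₂]`-module with a `τ`-anti-invariant bi-additive
pairing `B` whose value `δ₀ = B(P₀,P₀) − B(P₀,τP₀)` has full order `2^M` (perfectness), for `τx = x` of order `2^{N_x}` and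
`τy = −y` of order `2^{N_y}`: **`addOrderOf (B x y) = 2^(N_x + N_y − (M + 1))`** — exactly one bit is lost. At a Kolyvagin prime
over `K` this is the order of the local Tate pairing of an even-depth against an odd-depth Kolyvagin class.
[cite: McCallumLMS1991, §5 Lemma 5.3, Prop. 4.4; Kolyvagin1991MathAnn, Thm. 2.1] -/
theorem lostBit_addOrderOf_pairing_fixed_antifixed_of_delta (hδ : addOrderOf (B P₀ P₀ - B P₀ (τ P₀)) = 2 ^ M)
    {x y : A} (hx : τ x = x) (hy : τ y = -y) {Nx Ny : ℕ} (hNx : addOrderOf x = 2 ^ Nx) (hNy : addOrderOf y = 2 ^ Ny) :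
    addOrderOf (B x y) = 2 ^ (Nx + Ny - (M + 1)) := by
  obtain ⟨a, rfl⟩ := exists_eq_zsmul_norm_of_tau_eq τ hτ P₀ hspan hfree htor hx
  obtain ⟨c, rfl⟩ := exists_eq_zsmul_conorm_of_tau_eq_neg τ hτ P₀ hspan hfree htor hy
  have hn := addOrderOf_norm_eq τ P₀ hfree htor
  have hcn := addOrderOf_conorm_eq τ P₀ hfree htor
  -- `B (a•n₊) (c•n₋) = (a c) • (2 • δ₀)`
  have hB : B (a • (P₀ + τ P₀)) (c • (P₀ - τ P₀)) = (a * c) • (2 • (B P₀ P₀ - B P₀ (τ P₀))) := by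
    simp only [map_zsmul, AddMonoidHom.zsmul_apply]
    rw [pairing_norm_conorm τ hτ B hanti, smul_smul, mul_comm c a]
  rw [hB]
  -- `N_y ≤ M`
  have hNyM : Ny ≤ M := by
    have h : addOrderOf (c • (P₀ - τ P₀)) ∣ 2 ^ M := by
      rw [← hcn]
      exact addOrderOf_dvd_of_mem_zmultiples (AddSubgroup.zsmul_mem_zmultiples _ c)
    rw [hNy] at h
    exact (Nat.pow_dvd_pow_iff_le_right one_lt_two).mp h
  have hNxM : Nx ≤ M := by
    have h : addOrderOf (a • (P₀ + τ P₀)) ∣ 2 ^ M := by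
      rw [← hn]
      exact addOrderOf_dvd_of_mem_zmultiples (AddSubgroup.zsmul_mem_zmultiples _ a)
    rw [hNx] at h
    exact (Nat.pow_dvd_pow_iff_le_right one_lt_two).mp h
  -- normal forms of `a`, `c`
  rcases zsmul_eq_zero_or_eq_two_pow_mul_odd_nsmul hn a with ha0 | ⟨v, s, hv, hs, ha⟩
  · -- `x = 0`
    rw [ha0, addOrderOf_zero] at hNx
    have hNx0 : Nx = 0 := by
      have := eq_of_two_pow_eq_two_pow ((pow_zero 2).trans hNx)
      exact this.symm
    have hzero : (a * c) • (2 • (B P₀ P₀ - B P₀ (τ P₀))) = 0 := by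
      rw [← hB, ha0, map_zero, AddMonoidHom.zero_apply]
    rw [hzero, addOrderOf_zero, hNx0]
    have : 0 + Ny - (M + 1) = 0 := by omega
    rw [this, pow_zero]
  rcases zsmul_eq_zero_or_eq_two_pow_mul_odd_nsmul hcn c with hc0 | ⟨w, t, hw, ht, hc⟩
  · -- `y = 0`
    rw [hc0, addOrderOf_zero] at hNy
    have hNy0 : Ny = 0 := by
      have := eq_of_two_pow_eq_two_pow ((pow_zero 2).trans hNy)
      exact this.symm
    have hzero : (a * c) • (2 • (B P₀ P₀ - B P₀ (τ P₀))) = 0 := by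
      rw [← hB, hc0, map_zero]
    rw [hzero, addOrderOf_zero, hNy0]
    have : Nx + 0 - (M + 1) = 0 := by omega
    rw [this, pow_zero]
  -- generic case: read off the exponents
  rw [ha, addOrderOf_two_pow_mul_odd_nsmul hn hv.le hs] at hNx
  rw [hc, addOrderOf_two_pow_mul_odd_nsmul hcn hw.le ht] at hNy
  have hNx' : Nx = M - v := (eq_of_two_pow_eq_two_pow hNx).symm
  have hNy' : Ny = M - w := (eq_of_two_pow_eq_two_pow hNy).symm
  -- `(a c 2) • δ₀ = (2^v s · 2^w t · 2) • δ₀`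
  have hval : (a * c) • (2 • (B P₀ P₀ - B P₀ (τ P₀))) = ((2 ^ v * s) * (2 ^ w * t) * 2) • (B P₀ P₀ - B P₀ (τ P₀)) := by
    rw [← hB, ha, hc]
    simp only [map_nsmul, AddMonoidHom.nsmul_apply]
    rw [pairing_norm_conorm τ hτ B hanti, smul_smul, smul_smul]
    congr 1
    ring
  rw [hval, addOrderOf_prod_two_smul_eq hδ hv hw hs ht, hNx', hNy']

include hτ hanti hspan hfree htor in
/-- **THE LOST-BIT LAW (anti-fixed × fixed).** Same as `lostBit_addOrderOf_pairing_fixed_antifixed_of_delta` with the arguments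
in the other order; the perfectness input is now `δ₀′ = B(P₀,P₀) + B(P₀,τP₀)` of full order `2^M`.
[cite: McCallumLMS1991, §5 Lemma 5.3, Prop. 4.4] -/
theorem lostBit_addOrderOf_pairing_antifixed_fixed_of_delta (hδ' : addOrderOf (B P₀ P₀ + B P₀ (τ P₀)) = 2 ^ M)
    {y x : A} (hy : τ y = -y) (hx : τ x = x) {Ny Nx : ℕ} (hNy : addOrderOf y = 2 ^ Ny) (hNx : addOrderOf x = 2 ^ Nx) :
    addOrderOf (B y x) = 2 ^ (Ny + Nx - (M + 1)) := by
  obtain ⟨c, rfl⟩ := exists_eq_zsmul_conorm_of_tau_eq_neg τ hτ P₀ hspan hfree htor hy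
  obtain ⟨a, rfl⟩ := exists_eq_zsmul_norm_of_tau_eq τ hτ P₀ hspan hfree htor hx
  have hn := addOrderOf_norm_eq τ P₀ hfree htor
  have hcn := addOrderOf_conorm_eq τ P₀ hfree htor
  have hB : B (c • (P₀ - τ P₀)) (a • (P₀ + τ P₀)) = (c * a) • (2 • (B P₀ P₀ + B P₀ (τ P₀))) := by
    simp only [map_zsmul, AddMonoidHom.zsmul_apply]
    rw [pairing_conorm_norm τ hτ B hanti, smul_smul, mul_comm a c]
  rw [hB]
  have hNyM : Ny ≤ M := by
    have h : addOrderOf (c • (P₀ - τ P₀)) ∣ 2 ^ M := by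
      rw [← hcn]
      exact addOrderOf_dvd_of_mem_zmultiples (AddSubgroup.zsmul_mem_zmultiples _ c)
    rw [hNy] at h
    exact (Nat.pow_dvd_pow_iff_le_right one_lt_two).mp h
  have hNxM : Nx ≤ M := by
    have h : addOrderOf (a • (P₀ + τ P₀)) ∣ 2 ^ M := by
      rw [← hn]
      exact addOrderOf_dvd_of_mem_zmultiples (AddSubgroup.zsmul_mem_zmultiples _ a)
    rw [hNx] at h
    exact (Nat.pow_dvd_pow_iff_le_right one_lt_two).mp h
  rcases zsmul_eq_zero_or_eq_two_pow_mul_odd_nsmul hcn c with hc0 | ⟨w, t, hw, ht, hc⟩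
  · rw [hc0, addOrderOf_zero] at hNy
    have hNy0 : Ny = 0 := (eq_of_two_pow_eq_two_pow ((pow_zero 2).trans hNy)).symm
    have hzero : (c * a) • (2 • (B P₀ P₀ + B P₀ (τ P₀))) = 0 := by
      rw [← hB, hc0, map_zero, AddMonoidHom.zero_apply]
    rw [hzero, addOrderOf_zero, hNy0]
    have : 0 + Nx - (M + 1) = 0 := by omega
    rw [this, pow_zero]
  rcases zsmul_eq_zero_or_eq_two_pow_mul_odd_nsmul hn a with ha0 | ⟨v, s, hv, hs, ha⟩
  · rw [ha0, addOrderOf_zero] at hNx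
    have hNx0 : Nx = 0 := (eq_of_two_pow_eq_two_pow ((pow_zero 2).trans hNx)).symm
    have hzero : (c * a) • (2 • (B P₀ P₀ + B P₀ (τ P₀))) = 0 := by
      rw [← hB, ha0, map_zero]
    rw [hzero, addOrderOf_zero, hNx0]
    have : Ny + 0 - (M + 1) = 0 := by omega
    rw [this, pow_zero]
  rw [hc, addOrderOf_two_pow_mul_odd_nsmul hcn hw.le ht] at hNy
  rw [ha, addOrderOf_two_pow_mul_odd_nsmul hn hv.le hs] at hNx
  have hNy' : Ny = M - w := (eq_of_two_pow_eq_two_pow hNy).symm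
  have hNx' : Nx = M - v := (eq_of_two_pow_eq_two_pow hNx).symm
  have hval : (c * a) • (2 • (B P₀ P₀ + B P₀ (τ P₀))) = ((2 ^ w * t) * (2 ^ v * s) * 2) • (B P₀ P₀ + B P₀ (τ P₀)) := by
    rw [← hB, ha, hc]
    simp only [map_nsmul, AddMonoidHom.nsmul_apply]
    rw [pairing_conorm_norm τ hτ B hanti, smul_smul, smul_smul]
    congr 1
    ring
  rw [hval, addOrderOf_prod_two_smul_eq hδ' hw hv ht hs, hNy', hNx']

include hτ hanti hspan hfree htor in
/-- **THE LOST-BIT LAW for an ALTERNATING anti-invariant pairing (the Weil pairing at a Kolyvagin prime).** If moreover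
`B(x, x) = 0` and the basic value `B(P₀, τP₀)` has full order `2^M` (⟺ `B` is perfect on the free module), then for `τx = x` of
order `2^{N_x}` and `τy = −y` of order `2^{N_y}`, in EITHER order of the arguments,
**`addOrderOf (B x y) = addOrderOf (B y x) = 2^(N_x + N_y − (M + 1))`**. With `N = M − (divisibility)` on both sides of Kolyvagin's
two-term reciprocity the two lost bits cancel. [cite: McCallumLMS1991, §5 Lemma 5.3, Prop. 4.4; Kolyvagin1991MathAnn, Thm. 2.1] -/
theorem lostBit_addOrderOf_pairing_fixed_antifixed (halt : ∀ x, B x x = 0) (hunit : addOrderOf (B P₀ (τ P₀)) = 2 ^ M)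
    {x y : A} (hx : τ x = x) (hy : τ y = -y) {Nx Ny : ℕ} (hNx : addOrderOf x = 2 ^ Nx) (hNy : addOrderOf y = 2 ^ Ny) :
    addOrderOf (B x y) = 2 ^ (Nx + Ny - (M + 1)) ∧ addOrderOf (B y x) = 2 ^ (Nx + Ny - (M + 1)) := by
  have hδ : addOrderOf (B P₀ P₀ - B P₀ (τ P₀)) = 2 ^ M := by rw [halt, zero_sub, addOrderOf_neg, hunit]
  have hδ' : addOrderOf (B P₀ P₀ + B P₀ (τ P₀)) = 2 ^ M := by rw [halt, zero_add, hunit]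
  refine ⟨lostBit_addOrderOf_pairing_fixed_antifixed_of_delta τ hτ B hanti P₀ hspan hfree htor hδ hx hy hNx hNy, ?_⟩
  rw [lostBit_addOrderOf_pairing_antifixed_fixed_of_delta τ hτ B hanti P₀ hspan hfree htor hδ' hy hx hNy hNx, add_comm]

include hτ hanti hspan hfree htor in
/-- **Reading for the engine: vanishing threshold.** Under the hypotheses of `lostBit_addOrderOf_pairing_fixed_antifixed`,
`B x y = 0 ⟺ N_x + N_y ≤ M + 1`, and `2^j • B x y = 0 ⟺ N_x + N_y ≤ M + 1 + j` — a pairing of a fixed class of order `2^{N_x}`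
with an anti-fixed class of order `2^{N_y}` is non-zero as soon as `N_x + N_y ≥ M + 2`.
[cite: McCallumLMS1991, §5 proof of Prop. 5.2 (the λ′-term)] -/
theorem pow_smul_pairing_eq_zero_iff (halt : ∀ x, B x x = 0) (hunit : addOrderOf (B P₀ (τ P₀)) = 2 ^ M)
    {x y : A} (hx : τ x = x) (hy : τ y = -y) {Nx Ny : ℕ} (hNx : addOrderOf x = 2 ^ Nx) (hNy : addOrderOf y = 2 ^ Ny)
    (j : ℕ) : 2 ^ j • B x y = 0 ↔ Nx + Ny ≤ M + 1 + j := by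
  have h := (lostBit_addOrderOf_pairing_fixed_antifixed τ hτ B hanti P₀ hspan hfree htor halt hunit hx hy hNx hNy).1
  rw [← addOrderOf_dvd_iff_nsmul_eq_zero, h, Nat.pow_dvd_pow_iff_le_right one_lt_two]
  omega

end Law

/-! ## §4 Multiplicative form (pairing with values in a commutative group, e.g. roots of unity) -/

section Multiplicative

variable {A Rm : Type*} [AddCommGroup A] [CommGroup Rm]
  (τ : A →+ A) (hτ : ∀ x, τ (τ x) = x) (e : A → A → Rm)
  (hadd₁ : ∀ S₁ S₂ T, e (S₁ + S₂) T = e S₁ T * e S₂ T) (hadd₂ : ∀ S T₁ T₂, e S (T₁ + T₂) = e S T₁ * e S T₂)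
  (halt : ∀ T, e T T = 1) (hanti : ∀ S T, e (τ S) (τ T) = (e S T)⁻¹)
  {M : ℕ} (P₀ : A)
  (hspan : ∀ Q : A, ∃ a b : ℤ, Q = a • P₀ + b • τ P₀)
  (hfree : ∀ a b : ℤ, a • P₀ + b • τ P₀ = 0 → (2 ^ M : ℤ) ∣ a ∧ (2 ^ M : ℤ) ∣ b)
  (htor : (2 ^ M : ℤ) • P₀ = 0)

include hτ hadd₁ hadd₂ halt hanti hspan hfree htor in
/-- **THE LOST-BIT LAW, multiplicative values** (the shape of the tree's Weil-pairing hypotheses `hadd₁/hadd₂/halt` plus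
anti-invariance under `τ`, which is `hgal` at `σ = τ` composed with «`τ` inverts `μ_{2^M}`»): for `τx = x` of order `2^{N_x}`,
`τy = −y` of order `2^{N_y}`, and `e(P₀, τP₀)` of full order `2^M`, **`orderOf (e x y) = orderOf (e y x) = 2^(N_x + N_y − (M + 1))`**.
[cite: McCallumLMS1991, §5 Lemma 5.3, Prop. 4.4; SilvermanAEC2009, III.8.1 (Galois equivariance of the Weil pairing)] -/
theorem lostBit_orderOf_pairing_fixed_antifixed (hunit : orderOf (e P₀ (τ P₀)) = 2 ^ M)
    {x y : A} (hx : τ x = x) (hy : τ y = -y) {Nx Ny : ℕ} (hNx : addOrderOf x = 2 ^ Nx) (hNy : addOrderOf y = 2 ^ Ny) :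
    orderOf (e x y) = 2 ^ (Nx + Ny - (M + 1)) ∧ orderOf (e y x) = 2 ^ (Nx + Ny - (M + 1)) := by
  -- package `e` as a bi-additive map into `Additive Rm`
  let B : A →+ A →+ Additive Rm :=
    AddMonoidHom.mk' (fun S ↦ AddMonoidHom.mk' (fun T ↦ Additive.ofMul (e S T)) (fun T₁ T₂ ↦ by
      rw [hadd₂]; rfl)) (fun S₁ S₂ ↦ by
        ext T
        simp only [AddMonoidHom.mk'_apply, AddMonoidHom.add_apply, hadd₁]
        rfl)
  have hB : ∀ S T, B S T = Additive.ofMul (e S T) := fun _ _ ↦ rfl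
  have hanti' : ∀ x y, B (τ x) (τ y) = -B x y := fun x y ↦ by rw [hB, hB, hanti]; rfl
  have halt' : ∀ x, B x x = 0 := fun x ↦ by rw [hB, halt]; rfl
  have hunit' : addOrderOf (B P₀ (τ P₀)) = 2 ^ M := by rw [hB, addOrderOf_ofMul_eq_orderOf, hunit]
  have h := lostBit_addOrderOf_pairing_fixed_antifixed τ hτ B hanti' P₀ hspan hfree htor halt' hunit' hx hy hNx hNy
  rw [hB, hB, addOrderOf_ofMul_eq_orderOf, addOrderOf_ofMul_eq_orderOf] at h
  exact h

end Multiplicative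

end Summit.BirchSwinnertonDyer.BirchSwinnertonDyer.Theorems.GenusExact.PlusDescent
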